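import Summits.QuantumFields.BalabanUV.Beta.GAN24.ContactBorderEntryBoundTwoMf
import Summits.QuantumFields.BalabanUV.Beta.GAN24.Push3LegTelescope

/-!
# `BalabanUV.Beta.GAN24.ContactBorderPairEntryBound` — binder row G-an2-4 / (CONV-C), CT-ROUTE, «(V-C)-DIFF» (the CONTACT V PAIR letter of the born-V rate half), module (B):
# **THE TOP-ALIGNED PAIR OF THE V CONTACT CELLS TELESCOPES INTO THREE TWO-TOWER SOCKETS, AND ITS ENTRY BOUND FROM LETTERS** (generic `d`)

NOT IN PRINT; OUR BOOKKEEPING (G-an2-4 formalisation swarm → CRUX TEAM (2), leaf prover `b2b-balaban-gan24-formalise-leaf-03`, gen 56; «(V-C)-DIFF» INTENT journal `CLAIMS.log`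
[LEAF03-G56-ONLINE]).  [folklore] bookkeeping over leaf-04's «one leg at a time» identity `Push3LegTelescope.push₃_telescope` (summable class) and this seat's two-tower entry bounds
(A) `ContactBorderEntryBoundTwo.abs_contact_border_fm_le₂` ∕ (A′) `ContactBorderEntryBoundTwoMf.abs_contact_border_mf_le₂`, `AffineReproduction.dz_sub` BY NAME.  Generic `d`; every analytic
input a LETTER; 0 `def`, 0 cited facts, 0 `def … : Prop`, 0 sorry; NO estimate of Bałaban's.  HONEST FRAMING (cell contract, verbatim): «discharging `BetaPertH` makes Bałaban's UV
stability UNCONDITIONAL — a real constructive-QFT result; it is NOT the continuum limit and NOT the Clay problem.»  HONEST DEPENDENCY (verbatim): «continuum YM on T⁴ ⇐ BetaPertH ∧ nine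
spine estimates (0/9 proved); BetaPertH ⇐ (D1) ∧ (D4) ∧ CAP+tail; G-an2-4 gates asym, D1 and NE2/3/4.»

## Why
Per channel the V contact term of the lineage born at `i` in member `k = i+n+1` is `Q(T, B; M) = push₃ T M T S − push₃ B M B S` (fm; mf: `push₃ M′ T T S′ − push₃ M′ B B S′`), `T` the long
dressed chain, `B` its undressed counterpart, `T − B = dz λ`, `M` the common multiplier leg ((C1) `BornBorderContactNest`).  The member-`(k+1)` lineage born at `i+1` has the SAME relative
depth `n` and lives on the SAME lattice (top-aligned): data `(T⁺, B⁺, λ⁺, M⁺)`.  Telescoping the two readings one leg at a time and subtracting,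
`Q(T⁺,B⁺;M⁺) − Q(T,B;M) = [push₃ (T⁺−T) M⁺ T⁺ − push₃ (B⁺−B) M⁺ B⁺] + [push₃ T (M⁺−M) T⁺ − push₃ B (M⁺−M) B⁺] + [push₃ T M (T⁺−T) − push₃ B M (B⁺−B)]`:
three instances of leaf-02's factorised socket with INDEPENDENT left ∕ table pairs — (difference pair, taller pair; `M⁺`), (shorter, taller; `M⁺ − M`), (shorter, difference; `M`) — the
difference pair `(T⁺−T, B⁺−B)` being again (dressed-type, enveloped) with pure-gauge difference `dz (λ⁺ − λ)`.  Each is bounded by (A) ∕ (A′) with the difference tower's letters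
`(K_Δ, α_Δ)` and the differenced tent `T_Δ` — which at `d = 3` carry the Cauchy factor `θ^{i+n}` ((C) ∕ (D)).

## What (generic `d`, `1 ≤ Lc`, box root; ONE rate `κ`; `A(α) = 2α + 2α·Lc·n`, `P(a,b) = 4ab + 2(4ab)·Lc·n`; shorter-tower letters `(C_T, K_B, α_g)` ALSO bound the taller tower)
* §1 `pair_fm_eq_three ∕ pair_mf_eq_three` — the telescoping identities above (summable class: dressed legs bounded with summable fine slices, multipliers summable (mf: bounded), table
  `LocStencil S Cs δ`, `0 < δ`).
* §2 **`abs_contact_border_fm_pair_le`**: `|Q(T⁺,B⁺;M⁺) − Q(T,B;M)| (fm entries) ≤ (Lc^{d+1})⁻¹·((d+1)·(E₀²·Cnt))·[T_b·(K_B·A(α_Δ) + P(α_Δ,α_g) + K_Δ·A(α_g)) + T_Δ·(K_B·A(α_g) + P(α_g,α_g) +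
  K_B·A(α_g)) + T_b·(K_Δ·A(α_g) + P(α_g,α_Δ) + K_B·A(α_Δ))]·((Lc^n)^{d+1}·Zl(κ∕(4(d+1))))·e^{−(κ∕12)(‖x′−z′‖∞+‖u′−z′‖∞)}`.
* §3 **`abs_contact_border_mf_pair_le`**: the mf twin (envelope centred at `x′`).
NOT HERE: the `d = 3` letters, the weight and the unit count ((C) `BornBorderContactPairLineage`), the END ((D) `BornBorderContactPairBound`).  Discharges NO letter of (CONV-C); hBdev ∕
(hS, hSall) OPEN; NEVER «G-an2-4 closed» as (CONV-C); NOT D1, NOT BetaPertH, NOT continuum, NOT Clay.  Unit `b2b-balaban-gan24-formalise-leaf-03` (gen 56), 2026-08-21.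
-/

noncomputable section

open Finset
open scoped BigOperators
open Literature.MathematicalPhysics.QuantumFieldTheory
open Literature.MathematicalPhysics.QuantumFieldTheory.LatticeForm (quo)
open Literature.MathematicalPhysics.QuantumFieldTheory.Balaban1983to89
open Literature.MathematicalPhysics.QuantumFieldTheory.Balaban1983to89.Beta
open B4ContourShift (supNorm supNorm_nonneg)
open ExpKernelCalculus (MKer Zl Zl_nonneg)
open AffineAveraging (Form0 Form1 Site box toSite unitVec dz)
open AffineReproduction (dz_sub)
open AveragingContours (blk)
open AveragingHessianKernels (ell)
open AveragingHessianKernelsRooted (vhSAt)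
open OneStepResolventKernel (Fib LocStencil)
open Summit.QuantumFields.BalabanUV.Beta.GAN24.SrecLinearPartEq (reslot)
open Summit.QuantumFields.BalabanUV.Beta.GAN24.Push3 (push₃)
open Summit.QuantumFields.BalabanUV.Beta.GAN24.Push3LegTelescope (push₃_telescope abs_le_of_env' summable_of_env')
open Summit.QuantumFields.BalabanUV.Beta.GAN24.ContactBorderKernelCells (locStencil_reslot_vhSAt)
open Summit.QuantumFields.BalabanUV.Beta.GAN24.ContactBorderEntryBoundTwo (abs_contact_border_fm_le₂)
open Summit.QuantumFields.BalabanUV.Beta.GAN24.ContactBorderEntryBoundTwoMf (abs_contact_border_mf_le₂)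

namespace Summit.QuantumFields.BalabanUV.Beta.GAN24.ContactBorderPairEntryBound

variable {d : ℕ} {Lc : ℕ} {rr : Fin (d + 1) → ℕ}

/-! ## §1 The pair telescopes into three sockets -/

section Split

variable {S : Fin (d + 1) → (Fin (d + 1) → ℤ) → MKer (d + 1) (Fib d)} {Cs δ CT CTp CB CBp CM CMp : ℝ}
  {T B Tp Bp M Mp : Fin (d + 1) → (Fin (d + 1) → ℤ) → Fin (d + 1) → (Fin (d + 1) → ℤ) → ℝ}

/-- [folklore] **THE fm PAIR TELESCOPES INTO THREE SOCKETS** (summable class: `T, B, T⁺, B⁺` bounded with summable fine slices, `M, M⁺` summable fine columns, `LocStencil S Cs δ`, `0 < δ`):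
`(push₃ T⁺ M⁺ T⁺ S − push₃ B⁺ M⁺ B⁺ S) − (push₃ T M T S − push₃ B M B S)`
`= (push₃ (T⁺−T) M⁺ T⁺ S − push₃ (B⁺−B) M⁺ B⁺ S) + (push₃ T (M⁺−M) T⁺ S − push₃ B (M⁺−M) B⁺ S) + (push₃ T M (T⁺−T) S − push₃ B M (B⁺−B) S)` — `push₃_telescope` on the dressed and on the
undressed readings, subtracted. -/
theorem pair_fm_eq_three (hT : ∀ α x' κ x, |T α x' κ x| ≤ CT) (hTs : ∀ α x' κ, Summable fun x => T α x' κ x)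
    (hB : ∀ α x' κ x, |B α x' κ x| ≤ CB) (hBs : ∀ α x' κ, Summable fun x => B α x' κ x)
    (hTp : ∀ α x' κ x, |Tp α x' κ x| ≤ CTp) (hTps : ∀ α x' κ, Summable fun x => Tp α x' κ x)
    (hBp : ∀ α x' κ x, |Bp α x' κ x| ≤ CBp) (hBps : ∀ α x' κ, Summable fun x => Bp α x' κ x)
    (hMs : ∀ β z' κ, Summable fun z => M β z' κ z) (hMps : ∀ β z' κ, Summable fun z => Mp β z' κ z)
    (hS : LocStencil S Cs δ) (hδ : 0 < δ) (κ' : Fin (d + 1)) (u' : Fin (d + 1) → ℤ) :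
    (push₃ Tp Mp Tp S κ' u' - push₃ Bp Mp Bp S κ' u') - (push₃ T M T S κ' u' - push₃ B M B S κ' u')
      = (push₃ (Tp - T) Mp Tp S κ' u' - push₃ (Bp - B) Mp Bp S κ' u')
        + (push₃ T (Mp - M) Tp S κ' u' - push₃ B (Mp - M) Bp S κ' u')
        + (push₃ T M (Tp - T) S κ' u' - push₃ B M (Bp - B) S κ' u') := by
  have h1 := push₃_telescope (S := S) hTp hTps hT hTs hMps hMs hTp hT hS hδ κ' u'
  have h2 := push₃_telescope (S := S) hBp hBps hB hBs hMps hMs hBp hB hS hδ κ' u'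
  calc (push₃ Tp Mp Tp S κ' u' - push₃ Bp Mp Bp S κ' u') - (push₃ T M T S κ' u' - push₃ B M B S κ' u')
      = (push₃ Tp Mp Tp S κ' u' - push₃ T M T S κ' u') - (push₃ Bp Mp Bp S κ' u' - push₃ B M B S κ' u') := by abel
    _ = _ := by rw [h1, h2]; abel

/-- [folklore] **THE mf PAIR TELESCOPES INTO THREE SOCKETS** (multiplier LEFT legs `M′, M′⁺` bounded with summable fine slices; dressed ∕ undressed legs bounded, summable):
`(push₃ M′⁺ T⁺ T⁺ S′ − push₃ M′⁺ B⁺ B⁺ S′) − (push₃ M′ T T S′ − push₃ M′ B B S′)`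
`= (push₃ (M′⁺−M′) T⁺ T⁺ S′ − push₃ (M′⁺−M′) B⁺ B⁺ S′) + (push₃ M′ (T⁺−T) T⁺ S′ − push₃ M′ (B⁺−B) B⁺ S′) + (push₃ M′ T (T⁺−T) S′ − push₃ M′ B (B⁺−B) S′)`. -/
theorem pair_mf_eq_three (hM : ∀ α x' κ x, |M α x' κ x| ≤ CM) (hMs : ∀ α x' κ, Summable fun x => M α x' κ x)
    (hMp : ∀ α x' κ x, |Mp α x' κ x| ≤ CMp) (hMps : ∀ α x' κ, Summable fun x => Mp α x' κ x)
    (hT : ∀ β z' κ z, |T β z' κ z| ≤ CT) (hTs : ∀ β z' κ, Summable fun z => T β z' κ z)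
    (hB : ∀ β z' κ z, |B β z' κ z| ≤ CB) (hBs : ∀ β z' κ, Summable fun z => B β z' κ z)
    (hTp : ∀ β z' κ z, |Tp β z' κ z| ≤ CTp) (hTps : ∀ β z' κ, Summable fun z => Tp β z' κ z)
    (hBp : ∀ β z' κ z, |Bp β z' κ z| ≤ CBp) (hBps : ∀ β z' κ, Summable fun z => Bp β z' κ z)
    (hS : LocStencil S Cs δ) (hδ : 0 < δ) (κ' : Fin (d + 1)) (u' : Fin (d + 1) → ℤ) :
    (push₃ Mp Tp Tp S κ' u' - push₃ Mp Bp Bp S κ' u') - (push₃ M T T S κ' u' - push₃ M B B S κ' u')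
      = (push₃ (Mp - M) Tp Tp S κ' u' - push₃ (Mp - M) Bp Bp S κ' u')
        + (push₃ M (Tp - T) Tp S κ' u' - push₃ M (Bp - B) Bp S κ' u')
        + (push₃ M T (Tp - T) S κ' u' - push₃ M B (Bp - B) S κ' u') := by
  have h1 := push₃_telescope (S := S) hMp hMps hM hMs hTps hTs hTp hT hS hδ κ' u'
  have h2 := push₃_telescope (S := S) hMp hMps hM hMs hBps hBs hBp hB hS hδ κ' u'
  calc (push₃ Mp Tp Tp S κ' u' - push₃ Mp Bp Bp S κ' u') - (push₃ M T T S κ' u' - push₃ M B B S κ' u')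
      = (push₃ Mp Tp Tp S κ' u' - push₃ M T T S κ' u') - (push₃ Mp Bp Bp S κ' u' - push₃ M B B S κ' u') := by abel
    _ = _ := by rw [h1, h2]; abel

end Split

/-! ## §2 The entry bound of the fm pair -/

section Fm

variable [NeZero Lc] {n : ℕ} {κ αg αΔ KB KΔ CT CTp Tb TΔ : ℝ}
  {T B Tp Bp M Mp : Fin (d + 1) → (Fin (d + 1) → ℤ) → Fin (d + 1) → (Fin (d + 1) → ℤ) → ℝ}
  {lam lamp : Fin (d + 1) → (Fin (d + 1) → ℤ) → (Fin (d + 1) → ℤ) → ℝ}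
  {G Gp GΔ : Fin (d + 1) → (Fin (d + 1) → ℤ) → ℕ → Site (d + 1) → ℝ}

/-- NOT IN PRINT; OUR BOOKKEEPING ([folklore]; every analytic input a LETTER).  **THE ENTRY BOUND OF THE fm PAIR.**  Shorter tower `(T, B, λ, G)` and taller tower `(T⁺, B⁺, λ⁺, G⁺)` as in (B2)
(dressed legs bounded with summable fine slices, undressed legs under the block envelope `K_B` at blocking `Lc^{n+1}`, `T − B = dz λ`, staircases of depth `n+1` with localised geometric
pieces of letter `α_g` — the SAME letters for both towers), multipliers `M, M⁺` (summable fine slices, tent letter `T_b` at blocking `Lc^n`), and the DIFFERENCE letters: undressed legs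
`|B⁺ − B| ≤ K_Δ·e^{−κ‖quo (Lc^{n+1}) u − z‖∞}`, staircases `λ⁺ − λ = Σ_{s<n+1} G_Δ s ∘ blk (Lc^s)` with pieces of letter `α_Δ`, tents `|(M⁺ − M) β z′ μ (Lc•y)| ≤ T_Δ·e^{−κ‖quo (Lc^n) y − z′‖∞}`.
THEN for all `κ′ u′ x′ z′ α β` (fm entries, `S = reslot inl inr V_ρ`):
`|(push₃ T⁺ M⁺ T⁺ S − push₃ B⁺ M⁺ B⁺ S) − (push₃ T M T S − push₃ B M B S)| ≤ (Lc^{d+1})⁻¹·((d+1)·(E₀²·Cnt))·[T_b·(K_B·A(α_Δ) + P(α_Δ,α_g) + K_Δ·A(α_g)) + T_Δ·(K_B·A(α_g) + P(α_g,α_g) + K_B·A(α_g))`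
`+ T_b·(K_Δ·A(α_g) + P(α_g,α_Δ) + K_B·A(α_Δ))]·((Lc^n)^{d+1}·Zl(κ∕(4(d+1))))·e^{−(κ∕12)(‖x′−z′‖∞+‖u′−z′‖∞)}` — §1 and (A) thrice. -/
theorem abs_contact_border_fm_pair_le (hLc : 1 ≤ Lc) (hrr : rr ∈ box (d + 1) Lc) (hκ : 0 < κ) (hαg : 0 ≤ αg) (hαΔ : 0 ≤ αΔ) (hKB : 0 ≤ KB)
    (hKΔ : 0 ≤ KΔ) (hTb : 0 ≤ Tb) (hTΔ : 0 ≤ TΔ)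
    (hT : ∀ μ z κ u, |T μ z κ u| ≤ CT) (hTs : ∀ μ z κ, Summable fun u => T μ z κ u)
    (hB : ∀ μ z l u, |B μ z l u| ≤ KB * Real.exp (-(κ * supNorm (quo (Lc ^ (n + 1)) u - z))))
    (hTB : T - B = fun μ z κ u => dz (lam μ z) κ u)
    (hψ : ∀ μ₀ z₀ u, lam μ₀ z₀ u = ∑ s ∈ Finset.range (n + 1), G μ₀ z₀ s (blk (Lc ^ s) u))
    (hG : ∀ μ₀ z₀ s, s ≤ n → ∀ u, |G μ₀ z₀ s (blk (Lc ^ s) u)| ≤ αg * (Lc : ℝ) ^ s * Real.exp (-(κ * supNorm (quo (Lc ^ (n + 1)) u - z₀))))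
    (hTp : ∀ μ z κ u, |Tp μ z κ u| ≤ CTp) (hTps : ∀ μ z κ, Summable fun u => Tp μ z κ u)
    (hBp : ∀ μ z l u, |Bp μ z l u| ≤ KB * Real.exp (-(κ * supNorm (quo (Lc ^ (n + 1)) u - z))))
    (hTBp : Tp - Bp = fun μ z κ u => dz (lamp μ z) κ u)
    (hψp : ∀ μ₀ z₀ u, lamp μ₀ z₀ u = ∑ s ∈ Finset.range (n + 1), Gp μ₀ z₀ s (blk (Lc ^ s) u))
    (hGp : ∀ μ₀ z₀ s, s ≤ n → ∀ u, |Gp μ₀ z₀ s (blk (Lc ^ s) u)| ≤ αg * (Lc : ℝ) ^ s * Real.exp (-(κ * supNorm (quo (Lc ^ (n + 1)) u - z₀))))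
    (hBΔ : ∀ μ z l u, |Bp μ z l u - B μ z l u| ≤ KΔ * Real.exp (-(κ * supNorm (quo (Lc ^ (n + 1)) u - z))))
    (hψΔ : ∀ μ₀ z₀ u, lamp μ₀ z₀ u - lam μ₀ z₀ u = ∑ s ∈ Finset.range (n + 1), GΔ μ₀ z₀ s (blk (Lc ^ s) u))
    (hGΔ : ∀ μ₀ z₀ s, s ≤ n → ∀ u, |GΔ μ₀ z₀ s (blk (Lc ^ s) u)| ≤ αΔ * (Lc : ℝ) ^ s * Real.exp (-(κ * supNorm (quo (Lc ^ (n + 1)) u - z₀))))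
    (hMs : ∀ β z' μ, Summable fun z => M β z' μ z) (hMps : ∀ β z' μ, Summable fun z => Mp β z' μ z)
    (hMt : ∀ (β : Fin (d + 1)) (z' : Site (d + 1)) (μ : Fin (d + 1)) (y : Site (d + 1)),
      |M β z' μ ((Lc : ℤ) • y)| ≤ Tb * Real.exp (-(κ * supNorm (quo (Lc ^ n) y - z'))))
    (hMpt : ∀ (β : Fin (d + 1)) (z' : Site (d + 1)) (μ : Fin (d + 1)) (y : Site (d + 1)),
      |Mp β z' μ ((Lc : ℤ) • y)| ≤ Tb * Real.exp (-(κ * supNorm (quo (Lc ^ n) y - z'))))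
    (hMΔt : ∀ (β : Fin (d + 1)) (z' : Site (d + 1)) (μ : Fin (d + 1)) (y : Site (d + 1)),
      |Mp β z' μ ((Lc : ℤ) • y) - M β z' μ ((Lc : ℤ) • y)| ≤ TΔ * Real.exp (-(κ * supNorm (quo (Lc ^ n) y - z'))))
    (κ' : Fin (d + 1)) (u' x' z' : Site (d + 1)) (α β : Fin (d + 1)) :
    |(push₃ Tp Mp Tp (reslot Sum.inl Sum.inr (vhSAt (toSite rr) d Lc rfl)) κ' u' x' z' (Sum.inl α) (Sum.inl β)
          - push₃ Bp Mp Bp (reslot Sum.inl Sum.inr (vhSAt (toSite rr) d Lc rfl)) κ' u' x' z' (Sum.inl α) (Sum.inl β))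
        - (push₃ T M T (reslot Sum.inl Sum.inr (vhSAt (toSite rr) d Lc rfl)) κ' u' x' z' (Sum.inl α) (Sum.inl β)
          - push₃ B M B (reslot Sum.inl Sum.inr (vhSAt (toSite rr) d Lc rfl)) κ' u' x' z' (Sum.inl α) (Sum.inl β))|
      ≤ ((Lc : ℝ) ^ (d + 1))⁻¹ *
          ((((d : ℝ) + 1) * (Real.exp (2 * ((d : ℝ) + 1) * κ) ^ 2 *
              (((2 * Lc : ℕ) : ℝ) ^ (d + 1) * (((d + 1 : ℕ) : ℝ) * ((Lc : ℝ) ^ (d + 1) * (ell (d + 1) Lc : ℝ))))))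
            * (Tb * (KB * (2 * αΔ + 2 * αΔ * Lc * n) + (4 * (αΔ * αg) + 2 * (4 * (αΔ * αg)) * Lc * n) + KΔ * (2 * αg + 2 * αg * Lc * n))
              + TΔ * (KB * (2 * αg + 2 * αg * Lc * n) + (4 * (αg * αg) + 2 * (4 * (αg * αg)) * Lc * n) + KB * (2 * αg + 2 * αg * Lc * n))
              + Tb * (KΔ * (2 * αg + 2 * αg * Lc * n) + (4 * (αg * αΔ) + 2 * (4 * (αg * αΔ)) * Lc * n) + KB * (2 * αΔ + 2 * αΔ * Lc * n)))
            * ((((Lc ^ n : ℕ) : ℝ)) ^ (d + 1) * Zl (d + 1) (κ / (4 * ((d : ℝ) + 1))))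
            * Real.exp (-(κ / 12) * (supNorm (x' - z') + supNorm (u' - z')))) := by
  -- the classes: undressed legs enveloped ⇒ bounded and summable; the difference pair
  have hLn1 : 1 ≤ Lc ^ (n + 1) := Nat.one_le_pow _ _ hLc
  have hBb : ∀ μ z l u, |B μ z l u| ≤ KB := abs_le_of_env' hκ.le hB
  have hBs : ∀ μ z l, Summable fun u => B μ z l u := summable_of_env' hLn1 hκ hB
  have hBpb : ∀ μ z l u, |Bp μ z l u| ≤ KB := abs_le_of_env' hκ.le hBp
  have hBps : ∀ μ z l, Summable fun u => Bp μ z l u := summable_of_env' hLn1 hκ hBp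
  have hTΔ' : ∀ μ z κ u, |(Tp - T) μ z κ u| ≤ CTp + CT := fun μ z κ u => by
    simp only [Pi.sub_apply]
    exact (abs_sub _ _).trans (add_le_add (hTp μ z κ u) (hT μ z κ u))
  have hTΔs : ∀ μ z κ, Summable fun u => (Tp - T) μ z κ u := fun μ z κ =>
    ((hTps μ z κ).sub (hTs μ z κ)).congr fun u => by simp only [Pi.sub_apply]
  have hBΔ' : ∀ μ z l u, |(Bp - B) μ z l u| ≤ KΔ * Real.exp (-(κ * supNorm (quo (Lc ^ (n + 1)) u - z))) := fun μ z l u => by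
    simp only [Pi.sub_apply]; exact hBΔ μ z l u
  have hTBΔ : (Tp - T) - (Bp - B) = fun μ z κ u => dz (lamp μ z - lam μ z) κ u := by
    rw [show (Tp - T) - (Bp - B) = (Tp - Bp) - (T - B) by abel, hTBp, hTB]
    funext μ z κ u
    simp only [Pi.sub_apply, dz_sub]
  have hψΔ' : ∀ μ₀ z₀ u, (lamp μ₀ z₀ - lam μ₀ z₀) u = ∑ s ∈ Finset.range (n + 1), GΔ μ₀ z₀ s (blk (Lc ^ s) u) := fun μ₀ z₀ u => by
    rw [Pi.sub_apply]; exact hψΔ μ₀ z₀ u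
  have hMΔs : ∀ β z' μ, Summable fun z => (Mp - M) β z' μ z := fun β z' μ =>
    ((hMps β z' μ).sub (hMs β z' μ)).congr fun z => by simp only [Pi.sub_apply]
  have hMΔt' : ∀ (β : Fin (d + 1)) (z' : Site (d + 1)) (μ : Fin (d + 1)) (y : Site (d + 1)),
      |(Mp - M) β z' μ ((Lc : ℤ) • y)| ≤ TΔ * Real.exp (-(κ * supNorm (quo (Lc ^ n) y - z'))) := fun β z' μ y => by
    simp only [Pi.sub_apply]; exact hMΔt β z' μ y
  -- the telescoping, read entrywise
  have hS := locStencil_reslot_vhSAt (d := d) hLc hrr Sum.inl Sum.inr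
  have e := pair_fm_eq_three (S := reslot Sum.inl Sum.inr (vhSAt (toSite rr) d Lc rfl)) hT hTs hBb hBs hTp hTps hBpb hBps hMs hMps hS one_pos κ' u'
  have e' := congrFun (congrFun (congrFun (congrFun e x') z') (Sum.inl α)) (Sum.inl β)
  simp only [Pi.sub_apply, Pi.add_apply] at e'
  rw [e']
  -- the three sockets
  have h1 := abs_contact_border_fm_le₂ (d := d) (Lc := Lc) (rr := rr) (n := n) hLc hrr hκ hαΔ hαg hKΔ hKB hTb
    hTΔ' hTΔs hBΔ' hTBΔ hψΔ' hGΔ hTp hBp hTBp hψp hGp hMps hMpt κ' u' x' z' α β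
  have h2 := abs_contact_border_fm_le₂ (d := d) (Lc := Lc) (rr := rr) (n := n) hLc hrr hκ hαg hαg hKB hKB hTΔ
    hT hTs hB hTB hψ hG hTp hBp hTBp hψp hGp hMΔs hMΔt' κ' u' x' z' α β
  have h3 := abs_contact_border_fm_le₂ (d := d) (Lc := Lc) (rr := rr) (n := n) hLc hrr hκ hαg hαΔ hKB hKΔ hTb
    hT hTs hB hTB hψ hG hTΔ' hBΔ' hTBΔ hψΔ' hGΔ hMs hMt κ' u' x' z' α β
  refine ((abs_add_le _ _).trans (add_le_add ((abs_add_le _ _).trans (add_le_add h1 h2)) h3)).trans (le_of_eq ?_)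
  ring

end Fm

/-! ## §3 The entry bound of the mf pair -/

section Mf

variable [NeZero Lc] {n : ℕ} {κ αg αΔ KB KΔ CT CTp CM CMp Tb TΔ : ℝ}
  {T B Tp Bp M Mp : Fin (d + 1) → (Fin (d + 1) → ℤ) → Fin (d + 1) → (Fin (d + 1) → ℤ) → ℝ}
  {lam lamp : Fin (d + 1) → (Fin (d + 1) → ℤ) → (Fin (d + 1) → ℤ) → ℝ}
  {G Gp GΔ : Fin (d + 1) → (Fin (d + 1) → ℤ) → ℕ → Site (d + 1) → ℝ}

/-- NOT IN PRINT; OUR BOOKKEEPING ([folklore]; every analytic input a LETTER).  **THE ENTRY BOUND OF THE mf PAIR.**  Towers and difference letters as in §2; the multiplier LEFT legs `M′, M′⁺`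
bounded with summable fine slices, the tent of `M′` (centred at the output label `x′`) and the tent DIFFERENCE `T_Δ` (the taller multiplier's own tent is not needed: after the
telescoping only `M′⁺ − M′` and `M′` multiply).  THEN for all `κ′ u′ x′ z′ α β` (mf entries, `S′ = reslot inr inl V_ρ`):
`|(push₃ M′⁺ T⁺ T⁺ S′ − push₃ M′⁺ B⁺ B⁺ S′) − (push₃ M′ T T S′ − push₃ M′ B B S′)| ≤ (Lc^{d+1})⁻¹·((d+1)·(E₀²·Cnt))·[T_Δ·(K_B·A(α_g) + P(α_g,α_g) + K_B·A(α_g))`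
`+ T_b·(K_B·A(α_Δ) + P(α_Δ,α_g) + K_Δ·A(α_g)) + T_b·(K_Δ·A(α_g) + P(α_g,α_Δ) + K_B·A(α_Δ))]·((Lc^n)^{d+1}·Zl(κ∕(4(d+1))))·e^{−(κ∕12)(‖z′−x′‖∞+‖u′−x′‖∞)}`. -/
theorem abs_contact_border_mf_pair_le (hLc : 1 ≤ Lc) (hrr : rr ∈ box (d + 1) Lc) (hκ : 0 < κ) (hαg : 0 ≤ αg) (hαΔ : 0 ≤ αΔ) (hKB : 0 ≤ KB)
    (hKΔ : 0 ≤ KΔ) (hTb : 0 ≤ Tb) (hTΔ : 0 ≤ TΔ)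
    (hT : ∀ μ z κ u, |T μ z κ u| ≤ CT) (hTs : ∀ μ z κ, Summable fun u => T μ z κ u)
    (hB : ∀ μ z l u, |B μ z l u| ≤ KB * Real.exp (-(κ * supNorm (quo (Lc ^ (n + 1)) u - z))))
    (hTB : T - B = fun μ z κ u => dz (lam μ z) κ u)
    (hψ : ∀ μ₀ z₀ u, lam μ₀ z₀ u = ∑ s ∈ Finset.range (n + 1), G μ₀ z₀ s (blk (Lc ^ s) u))
    (hG : ∀ μ₀ z₀ s, s ≤ n → ∀ u, |G μ₀ z₀ s (blk (Lc ^ s) u)| ≤ αg * (Lc : ℝ) ^ s * Real.exp (-(κ * supNorm (quo (Lc ^ (n + 1)) u - z₀))))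
    (hTp : ∀ μ z κ u, |Tp μ z κ u| ≤ CTp) (hTps : ∀ μ z κ, Summable fun u => Tp μ z κ u)
    (hBp : ∀ μ z l u, |Bp μ z l u| ≤ KB * Real.exp (-(κ * supNorm (quo (Lc ^ (n + 1)) u - z))))
    (hTBp : Tp - Bp = fun μ z κ u => dz (lamp μ z) κ u)
    (hψp : ∀ μ₀ z₀ u, lamp μ₀ z₀ u = ∑ s ∈ Finset.range (n + 1), Gp μ₀ z₀ s (blk (Lc ^ s) u))
    (hGp : ∀ μ₀ z₀ s, s ≤ n → ∀ u, |Gp μ₀ z₀ s (blk (Lc ^ s) u)| ≤ αg * (Lc : ℝ) ^ s * Real.exp (-(κ * supNorm (quo (Lc ^ (n + 1)) u - z₀))))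
    (hBΔ : ∀ μ z l u, |Bp μ z l u - B μ z l u| ≤ KΔ * Real.exp (-(κ * supNorm (quo (Lc ^ (n + 1)) u - z))))
    (hψΔ : ∀ μ₀ z₀ u, lamp μ₀ z₀ u - lam μ₀ z₀ u = ∑ s ∈ Finset.range (n + 1), GΔ μ₀ z₀ s (blk (Lc ^ s) u))
    (hGΔ : ∀ μ₀ z₀ s, s ≤ n → ∀ u, |GΔ μ₀ z₀ s (blk (Lc ^ s) u)| ≤ αΔ * (Lc : ℝ) ^ s * Real.exp (-(κ * supNorm (quo (Lc ^ (n + 1)) u - z₀))))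
    (hM : ∀ α x' μ x, |M α x' μ x| ≤ CM) (hMs : ∀ α x' μ, Summable fun x => M α x' μ x)
    (hMp : ∀ α x' μ x, |Mp α x' μ x| ≤ CMp) (hMps : ∀ α x' μ, Summable fun x => Mp α x' μ x)
    (hMt : ∀ (α : Fin (d + 1)) (x' : Site (d + 1)) (μ : Fin (d + 1)) (y : Site (d + 1)),
      |M α x' μ ((Lc : ℤ) • y)| ≤ Tb * Real.exp (-(κ * supNorm (quo (Lc ^ n) y - x'))))
    (hMΔt : ∀ (α : Fin (d + 1)) (x' : Site (d + 1)) (μ : Fin (d + 1)) (y : Site (d + 1)),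
      |Mp α x' μ ((Lc : ℤ) • y) - M α x' μ ((Lc : ℤ) • y)| ≤ TΔ * Real.exp (-(κ * supNorm (quo (Lc ^ n) y - x'))))
    (κ' : Fin (d + 1)) (u' x' z' : Site (d + 1)) (α β : Fin (d + 1)) :
    |(push₃ Mp Tp Tp (reslot Sum.inr Sum.inl (vhSAt (toSite rr) d Lc rfl)) κ' u' x' z' (Sum.inl α) (Sum.inl β)
          - push₃ Mp Bp Bp (reslot Sum.inr Sum.inl (vhSAt (toSite rr) d Lc rfl)) κ' u' x' z' (Sum.inl α) (Sum.inl β))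
        - (push₃ M T T (reslot Sum.inr Sum.inl (vhSAt (toSite rr) d Lc rfl)) κ' u' x' z' (Sum.inl α) (Sum.inl β)
          - push₃ M B B (reslot Sum.inr Sum.inl (vhSAt (toSite rr) d Lc rfl)) κ' u' x' z' (Sum.inl α) (Sum.inl β))|
      ≤ ((Lc : ℝ) ^ (d + 1))⁻¹ *
          ((((d : ℝ) + 1) * (Real.exp (2 * ((d : ℝ) + 1) * κ) ^ 2 *
              (((2 * Lc : ℕ) : ℝ) ^ (d + 1) * (((d + 1 : ℕ) : ℝ) * ((Lc : ℝ) ^ (d + 1) * (ell (d + 1) Lc : ℝ))))))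
            * (TΔ * (KB * (2 * αg + 2 * αg * Lc * n) + (4 * (αg * αg) + 2 * (4 * (αg * αg)) * Lc * n) + KB * (2 * αg + 2 * αg * Lc * n))
              + Tb * (KB * (2 * αΔ + 2 * αΔ * Lc * n) + (4 * (αΔ * αg) + 2 * (4 * (αΔ * αg)) * Lc * n) + KΔ * (2 * αg + 2 * αg * Lc * n))
              + Tb * (KΔ * (2 * αg + 2 * αg * Lc * n) + (4 * (αg * αΔ) + 2 * (4 * (αg * αΔ)) * Lc * n) + KB * (2 * αΔ + 2 * αΔ * Lc * n)))
            * ((((Lc ^ n : ℕ) : ℝ)) ^ (d + 1) * Zl (d + 1) (κ / (4 * ((d : ℝ) + 1))))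
            * Real.exp (-(κ / 12) * (supNorm (z' - x') + supNorm (u' - x')))) := by
  have hLn1 : 1 ≤ Lc ^ (n + 1) := Nat.one_le_pow _ _ hLc
  have hBb : ∀ μ z l u, |B μ z l u| ≤ KB := abs_le_of_env' hκ.le hB
  have hBs : ∀ μ z l, Summable fun u => B μ z l u := summable_of_env' hLn1 hκ hB
  have hBpb : ∀ μ z l u, |Bp μ z l u| ≤ KB := abs_le_of_env' hκ.le hBp
  have hBps : ∀ μ z l, Summable fun u => Bp μ z l u := summable_of_env' hLn1 hκ hBp
  have hTΔ' : ∀ μ z κ u, |(Tp - T) μ z κ u| ≤ CTp + CT := fun μ z κ u => by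
    simp only [Pi.sub_apply]
    exact (abs_sub _ _).trans (add_le_add (hTp μ z κ u) (hT μ z κ u))
  have hTΔs : ∀ μ z κ, Summable fun u => (Tp - T) μ z κ u := fun μ z κ =>
    ((hTps μ z κ).sub (hTs μ z κ)).congr fun u => by simp only [Pi.sub_apply]
  have hBΔ' : ∀ μ z l u, |(Bp - B) μ z l u| ≤ KΔ * Real.exp (-(κ * supNorm (quo (Lc ^ (n + 1)) u - z))) := fun μ z l u => by
    simp only [Pi.sub_apply]; exact hBΔ μ z l u
  have hTBΔ : (Tp - T) - (Bp - B) = fun μ z κ u => dz (lamp μ z - lam μ z) κ u := by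
    rw [show (Tp - T) - (Bp - B) = (Tp - Bp) - (T - B) by abel, hTBp, hTB]
    funext μ z κ u
    simp only [Pi.sub_apply, dz_sub]
  have hψΔ' : ∀ μ₀ z₀ u, (lamp μ₀ z₀ - lam μ₀ z₀) u = ∑ s ∈ Finset.range (n + 1), GΔ μ₀ z₀ s (blk (Lc ^ s) u) := fun μ₀ z₀ u => by
    rw [Pi.sub_apply]; exact hψΔ μ₀ z₀ u
  have hMΔ' : ∀ α x' μ x, |(Mp - M) α x' μ x| ≤ CMp + CM := fun α x' μ x => by
    simp only [Pi.sub_apply]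
    exact (abs_sub _ _).trans (add_le_add (hMp α x' μ x) (hM α x' μ x))
  have hMΔs : ∀ α x' μ, Summable fun x => (Mp - M) α x' μ x := fun α x' μ =>
    ((hMps α x' μ).sub (hMs α x' μ)).congr fun x => by simp only [Pi.sub_apply]
  have hMΔt' : ∀ (α : Fin (d + 1)) (x' : Site (d + 1)) (μ : Fin (d + 1)) (y : Site (d + 1)),
      |(Mp - M) α x' μ ((Lc : ℤ) • y)| ≤ TΔ * Real.exp (-(κ * supNorm (quo (Lc ^ n) y - x'))) := fun α x' μ y => by
    simp only [Pi.sub_apply]; exact hMΔt α x' μ y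
  -- the telescoping, read entrywise
  have hS := locStencil_reslot_vhSAt (d := d) hLc hrr Sum.inr Sum.inl
  have e := pair_mf_eq_three (S := reslot Sum.inr Sum.inl (vhSAt (toSite rr) d Lc rfl)) hM hMs hMp hMps hT hTs hBb hBs hTp hTps hBpb hBps hS one_pos κ' u'
  have e' := congrFun (congrFun (congrFun (congrFun e x') z') (Sum.inl α)) (Sum.inl β)
  simp only [Pi.sub_apply, Pi.add_apply] at e'
  rw [e']
  -- the three sockets
  have h1 := abs_contact_border_mf_le₂ (d := d) (Lc := Lc) (rr := rr) (n := n) hLc hrr hκ hαg hαg hKB hKB hTΔ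
    hTp hTps hBp hTBp hψp hGp hTp hBp hTBp hψp hGp hMΔ' hMΔs hMΔt' κ' u' x' z' α β
  have h2 := abs_contact_border_mf_le₂ (d := d) (Lc := Lc) (rr := rr) (n := n) hLc hrr hκ hαΔ hαg hKΔ hKB hTb
    hTΔ' hTΔs hBΔ' hTBΔ hψΔ' hGΔ hTp hBp hTBp hψp hGp hM hMs hMt κ' u' x' z' α β
  have h3 := abs_contact_border_mf_le₂ (d := d) (Lc := Lc) (rr := rr) (n := n) hLc hrr hκ hαg hαΔ hKB hKΔ hTb
    hT hTs hB hTB hψ hG hTΔ' hBΔ' hTBΔ hψΔ' hGΔ hM hMs hMt κ' u' x' z' α β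
  refine ((abs_add_le _ _).trans (add_le_add ((abs_add_le _ _).trans (add_le_add h1 h2)) h3)).trans (le_of_eq ?_)
  ring

end Mf

end Summit.QuantumFields.BalabanUV.Beta.GAN24.ContactBorderPairEntryBound

end
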